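import Summits.ResolutionOfSingularities.ResolutionOfSingularities.Theorems.EquisingularLiftEquisingularLiftNatF102IsoOfIdealModules
import Summits.ResolutionOfSingularities.ResolutionOfSingularities.Theorems.EquisingularLiftEquisingularLiftNatModelStep
import Literature.AlgebraicGeometry.Modules.SheafHomFrames
import Literature.AlgebraicGeometry.Modules.PullbackUnitSections
import HarnessLib

/-!
# [OURS · L1 W4.5(b) · LINE (T-j)-PROOF · BRICK B4, sub-brick (B4-d′)] From the lifted generator of `i^*𝓗om(𝓘_{D₀}, 𝓘_{D₁})` to
# «`u` is onto modulo `ϖ` near the closed fibre» (the hypothesis of (B4-e) `isIso_of_surjective_mod`)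

Crux chain w45b (cell `res-hironaka`), EL♮(3) stmt-ResolutionOfSingularities-20148, LINE (T-j)-PROOF of F-102
`Literature.AlgebraicGeometry.Resolution.GenusZeroOverCompleteDVR` (res-L1-w45b-lead-2 g3, skeleton v3 1683bb741349c142), BRICK B4
`F102.exists_coordinate_functions`: the glue between res-L1-w45b-lead-2's (d) `F102.exists_unitSection_sheafHom_idealModule_eq`
(…NatF102HomLift: every global section of `i^*𝓗om(𝓘₀, 𝓘₁)` lifts to `Γ(C, 𝓗om(𝓘₀, 𝓘₁))`) and res-L1-type-o6's (e)
`F102.isIso_of_surjective_mod` (p579522). Desk res-L1-w45b-plan-1 g17 2026-08-27T22:30:29Z (i); res-L1-type-o6 g30 (final cycle). OURS;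
NOT a statement of any manuscript; AI-written, weaker than expert review. No `sorry`; standard axioms; DEF-FREE.
`--supports stmt-ResolutionOfSingularities-20148 --as helper`.

THEOREM (`surjective_mod_of_unitSection_eq`). `i : Ck → C` with `(i, t; f, Spec θ)` cartesian, `θ : O ↠ k` (`O` local, `k` a field), `C`
integral and locally Noetherian; `s : T → C`, `s' : T' → C` regular immersions of codimension one; `N = 𝓗om(𝓘_s, 𝓘_{s'})`;
`eN : i^*N ≅ 𝒪_{Ck}`; `u ∈ Γ(C, N) = Hom(𝓘_s, 𝓘_{s'})` (over `⊤`) whose pull-back `η(u)` is the generator `eN⁻¹(1)`. THEN every point `x`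
over the closed point has a neighbourhood `V_x` such that for every affine `V ⊆ V_x` the map `u_V : Γ(V, 𝓘_s) → Γ(V, 𝓘_{s'})` is ONTO
(so a fortiori onto modulo `ϖ`, with error term `0`).

PROOF. Near `x` both ideals are free of rank one ((B4-e) `exists_affine_principal`, (B4-a1) `nonempty_free_iso_over_idealModule_of_span_singleton`):
frames `e₀`, `e₁` on an affine `V ∋ x`. The matrix unit `β = homBasis e₀ e₁ (⋆,⋆)` generates `Hom(𝓘_s|_V, 𝓘_{s'}|_V)`
(`Modules.eq_sum_coord_smul_homBasis`): `u|_V = q • β`. Downstairs, `η(u|_V) = i^♯(q) • η(β)` is the generator `eN⁻¹(1)|`, so applying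
`eN`: `1 = i^♯(q) · eN(η(β))` in `Γ(i⁻¹V, 𝒪_{Ck})`, i.e. `i^♯(q)` is a unit; at the point `z` of `Ck` over `x` the local homomorphism
`i^♯_z` then shows that the germ `q_x` is a unit: `x ∈ C_q`. On an affine `V'' ⊆ C_q`: `u|_{V''} = q| • β|` with `q|` a unit, and
`β|(c q|⁻¹ b₀|) = c q|⁻¹ b₁|`, so every `b = c • b₁| ∈ Γ(V'', 𝓘_{s'})` (basis expansion) is a value of `u`.

References: R. Hartshorne, *Algebraic Geometry* (1977), II §5 (sheaf Hom, `f^*`), II Ex. 5.1 (b) [cite: Hartshorne1977]; The Stacks Project,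
Tag 01CM [cite: StacksProject]. Tree: `Modules/SheafHom`, `Modules/SheafHomFrames`, `Modules/LocalFrames`, `Modules/PullbackUnitSections`,
res-type-100's `…NatModelStep` (`range_eq_preimage_of_isPullback`, `range_specMap_of_surjective_of_field`).
-/

set_option linter.dupNamespace false -- mandated namespace `Summit.<Summit>.<Problem>` of this single-conjunct summit

noncomputable section

open CategoryTheory CategoryTheory.Limits AlgebraicGeometry Opposite TopologicalSpace
open Literature.AlgebraicGeometry.Modules Literature.AlgebraicGeometry.Morphisms
open Literature.AlgebraicGeometry.Deformation Literature.AlgebraicGeometry.Motives Literature.AlgebraicGeometry.HodgeTheory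
open Summit.ResolutionOfSingularities.ResolutionOfSingularities.Cruxes.EquisingularLiftNat.Sections

namespace Summit.ResolutionOfSingularities.ResolutionOfSingularities.Cruxes.EquisingularLiftNat.F102

variable {C : Scheme.{0}}

/-! ## Rank-one frames of the two ideals on a common affine open -/

/-- Near every point of an integral locally Noetherian `C`, the ideals of two codimension-one regular immersions are free of rank one on a
common affine open (frames indexed by `PUnit`), and the same holds on every smaller affine open. [OURS · glue] -/
theorem exists_nhd_frames [IsIntegral C] [IsLocallyNoetherian C] {T T' : Scheme.{0}} (s : T ⟶ C) (s' : T' ⟶ C)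
    (hs : IsRegularImmersionOfCodim s 1) (hs' : IsRegularImmersionOfCodim s' 1) (x : C) :
    ∃ Vx : C.Opens, x ∈ Vx ∧ ∀ V : C.affineOpens, (V : C.Opens) ≤ Vx → x ∈ (V : C.Opens) →
      Nonempty (SheafOfModules.free PUnit.{1} ≅ (idealModule s).over (V : C.Opens)) ∧
      Nonempty (SheafOfModules.free PUnit.{1} ≅ (idealModule s').over (V : C.Opens)) := by
  haveI : IsClosedImmersion s := hs.1
  haveI : IsClosedImmersion s' := hs'.1
  obtain ⟨V₀, hxV₀, r₀, hr₀, hI₀⟩ := exists_affine_principal s hs x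
  obtain ⟨V₁, hxV₁, r₁, hr₁, hI₁⟩ := exists_affine_principal s' hs' x
  refine ⟨(V₀ : C.Opens) ⊓ (V₁ : C.Opens), ⟨hxV₀, hxV₁⟩, fun V hV hxV => ?_⟩
  have hVV₀ : V ≤ V₀ := fun y hy => (hV hy).1
  have hVV₁ : V ≤ V₁ := fun y hy => (hV hy).2
  haveI : Nonempty (V : C.Opens) := ⟨⟨x, hxV⟩⟩
  have h0 : ∀ (r : Γ(C, (V : C.Opens))), r ≠ 0 → ∀ a : Γ(C, (V : C.Opens)), a * r = 0 → a = 0 :=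
    fun r hr a ha => (mul_eq_zero.mp ha).resolve_right hr
  exact ⟨nonempty_free_iso_over_idealModule_of_span_singleton s V _
      (h0 _ (map_ne_zero_of_ne_zero hVV₀ r₀ hr₀)) (principal_of_le s hVV₀ r₀ hI₀).symm,
    nonempty_free_iso_over_idealModule_of_span_singleton s' V _
      (h0 _ (map_ne_zero_of_ne_zero hVV₁ r₁ hr₁)) (principal_of_le s' hVV₁ r₁ hI₁).symm⟩

/-! ## The matrix unit of two rank-one frames -/

section MatrixUnit

variable {E M : C.Modules} {W V : C.Opens} (e₀ : SheafOfModules.free PUnit.{1} ≅ E.over W)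
  (e₁ : SheafOfModules.free PUnit.{1} ≅ M.over W)

/-- **Rank one: every `ψ : E|_W → M|_W` is a multiple of the matrix unit** `β = homBasis e₀ e₁ (⋆,⋆)`. [cite: Hartshorne1977, II Ex. 5.1 (b)] -/
theorem exists_eq_smul_homBasis (ψ : E.over W ⟶ M.over W) :
    ∃ q : Γ(C, W), ψ = q • homBasis e₀ e₁ (PUnit.unit, PUnit.unit) := by
  have h := eq_sum_coord_smul_homBasis e₀ e₁ (𝟙 W) ψ
  rw [Fintype.sum_subsingleton _ (PUnit.unit, PUnit.unit)] at h
  exact ⟨_, h.trans (by rw [restrictHom_id'])⟩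

/-- **Values of a multiple of the matrix unit hit everything when the multiplier is a unit**: for `V ≤ W` and `q|_V` a unit, every
`b ∈ Γ(M, V)` is `(q • β)_V(a)` for some `a ∈ Γ(E, V)`. [cite: Hartshorne1977, II Ex. 5.1 (b)] -/
theorem exists_appLE_smul_homBasis_eq (k : V ⟶ W) (q : Γ(C, W)) (hq : IsUnit (C.presheaf.map k.op q)) (b : Γ(M, V)) :
    ∃ a : Γ(E, V), appLE (q • homBasis e₀ e₁ (PUnit.unit, PUnit.unit)) k a = b := by
  classical
  obtain ⟨qi, hqi⟩ := hq.exists_right_inv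
  refine ⟨(qi * coord e₁ k b PUnit.unit) • E.presheaf.map k.op (basisSection e₀ PUnit.unit), ?_⟩
  rw [appLE_smul, appLE_smul_right, appLE_homBasis_map_basisSection, if_pos rfl, smul_smul, ← mul_assoc, hqi, one_mul]
  have hb := eq_sum_coord_smul e₁ k b
  rw [Fintype.sum_unique] at hb
  exact hb.symm

end MatrixUnit

/-! ## (B4-d′) -/

section Main

variable {O : Type} [CommRing O] [IsLocalRing O] {k : Type} [Field k] (θ : O →+* k)
  (f : C ⟶ Spec (.of O)) {Ck : Scheme.{0}} (i : Ck ⟶ C) (t : Ck ⟶ Spec (.of k))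
  {T T' : Scheme.{0}} (s : T ⟶ C) (s' : T' ⟶ C)

/-- **(B4-d′) From the lifted generator to surjectivity near the closed fibre.** See the module docstring. The conclusion is LITERALLY the
hypothesis `hu` of (B4-e) `isIso_of_surjective_mod` for the morphism `ū : 𝓘_s → 𝓘_{s'}` with `ū.app V a = appLE u (homOfLE le_top) a`
(`Modules.homOfOverCover` of `u`), with error term `c = 0`. [cite: Hartshorne1977, II Ex. 5.1 (b)] [OURS · L1 W4.5b · brick B4 (d′)] toward
`F102.exists_coordinate_functions`; NOT a statement of the manuscript. -/
theorem surjective_mod_of_unitSection_eq [IsIntegral C] [IsLocallyNoetherian C] (hθ : Function.Surjective θ)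
    (hsq : IsPullback i t f (Spec.map (CommRingCat.ofHom θ)))
    (hs : IsRegularImmersionOfCodim s 1) (hs' : IsRegularImmersionOfCodim s' 1)
    (eN : (Scheme.Modules.pullback i).obj (sheafHom (idealModule s) (idealModule s')) ≅ unitModule Ck)
    (u : Γ(sheafHom (idealModule s) (idealModule s'), ⊤))
    (hu : unitSection i (sheafHom (idealModule s) (idealModule s')) ⊤ u = eN.inv.app (i ⁻¹ᵁ ⊤) (1 : Γ(Ck, i ⁻¹ᵁ ⊤)))
    (ϖ : O) :
    ∀ x : C, f.base x = IsLocalRing.closedPoint O → ∃ Vx : C.Opens, x ∈ Vx ∧ ∀ V : C.affineOpens, (V : C.Opens) ≤ Vx →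
      ∀ b : Γ(idealModule s', (V : C.Opens)), ∃ (a : Γ(idealModule s, (V : C.Opens))) (c : Γ(idealModule s', (V : C.Opens))),
        b = appLE (u : (idealModule s).over ⊤ ⟶ (idealModule s').over ⊤) (homOfLE le_top) a +
          (f.appTop ((Scheme.ΓSpecIso (.of O)).inv ϖ) |_ (V : C.Opens)) • c := by
  classical
  intro x hx
  -- `x = i z`
  have hxr : x ∈ Set.range i := by
    rw [range_eq_preimage_of_isPullback hsq, range_specMap_of_surjective_of_field θ hθ]; exact hx
  obtain ⟨z, rfl⟩ := hxr
  -- frames near `x` on an affine `V`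
  obtain ⟨Vx, hxVx, hfr⟩ := exists_nhd_frames s s' hs hs' (i z)
  obtain ⟨_, ⟨V, hV, rfl⟩, hxV, hVsub⟩ := C.isBasis_affineOpens.exists_subset_of_mem_open hxVx Vx.isOpen
  obtain ⟨⟨e₀⟩, ⟨e₁⟩⟩ := hfr ⟨V, hV⟩ hVsub hxV
  -- `u|_V = q • β`
  set kV : V ⟶ ⊤ := homOfLE le_top with hkV
  set uV : (idealModule s).over V ⟶ (idealModule s').over V :=
    restrictHom kV (u : (idealModule s).over ⊤ ⟶ (idealModule s').over ⊤) with huV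
  obtain ⟨q, hq⟩ := exists_eq_smul_homBasis e₀ e₁ uV
  -- downstairs: `η(u|_V) = i^♯(q) • η(β)` is the generator, so `i^♯(q)` is a unit
  have hres : unitSection i (sheafHom (idealModule s) (idealModule s')) V
        (uV : Γ(sheafHom (idealModule s) (idealModule s'), V)) =
      ((Scheme.Modules.pullback i).obj (sheafHom (idealModule s) (idealModule s'))).presheaf.map
        ((Opens.map i.base).map kV).op (unitSection i (sheafHom (idealModule s) (idealModule s')) ⊤ u) := by
    rw [← unitSection_map]
    rfl
  have hunit : IsUnit (i.app V q) := by
    set W : Ck.Opens := i ⁻¹ᵁ V with hW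
    set a : Γ(Ck, W) := (eN.hom.app W (unitSection i (sheafHom (idealModule s) (idealModule s')) V
      (homBasis e₀ e₁ (PUnit.unit, PUnit.unit) : Γ(sheafHom (idealModule s) (idealModule s'), V))) :
        Γ(unitModule Ck, W)) with ha
    have hone : eN.hom.app (i ⁻¹ᵁ ⊤) (eN.inv.app (i ⁻¹ᵁ ⊤) (1 : Γ(Ck, i ⁻¹ᵁ ⊤))) = (1 : Γ(Ck, i ⁻¹ᵁ ⊤)) := by
      rw [← CategoryTheory.comp_apply, ← Scheme.Modules.Hom.comp_app, eN.inv_hom_id, Scheme.Modules.Hom.id_app]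
      rfl
    have h1 : eN.hom.app W (unitSection i (sheafHom (idealModule s) (idealModule s')) V
        (uV : Γ(sheafHom (idealModule s) (idealModule s'), V))) = (1 : Γ(Ck, W)) := by
      rw [hres, hu, ← map_app_section, hone]
      change Ck.presheaf.map _ 1 = 1
      exact map_one _
    have e1 : unitSection i (sheafHom (idealModule s) (idealModule s')) V (q • homBasis e₀ e₁ (PUnit.unit, PUnit.unit)) =
        i.app V q • unitSection i (sheafHom (idealModule s) (idealModule s')) V
          (homBasis e₀ e₁ (PUnit.unit, PUnit.unit) : Γ(sheafHom (idealModule s) (idealModule s'), V)) :=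
      unitSection_smul i (sheafHom (idealModule s) (idealModule s')) V q _
    have h2 : eN.hom.app W (unitSection i (sheafHom (idealModule s) (idealModule s')) V
        (uV : Γ(sheafHom (idealModule s) (idealModule s'), V))) = i.app V q • a := by
      rw [hq, e1, Scheme.Modules.Hom.app_smul]
      rfl
    rw [h2] at h1
    exact IsUnit.of_mul_eq_one a h1
  -- hence the germ of `q` at `x = i z` is a unit: `x ∈ C_q`
  have hxq : i z ∈ C.basicOpen q := by
    have hz : z ∈ i ⁻¹ᵁ V := hxV
    have hg : IsUnit ((i.stalkMap z).hom (C.presheaf.germ V (i z) hxV q)) := by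
      rw [Scheme.Hom.germ_stalkMap_apply]
      exact hunit.map _
    exact (Scheme.mem_basicOpen _ _ (i z) hxV).mpr ((isUnit_map_iff (i.stalkMap z).hom _).mp hg)
  -- the neighbourhood `C_q`
  refine ⟨C.basicOpen q, hxq, fun V' hV' b => ?_⟩
  have hV'V : (V' : C.Opens) ≤ V := fun y hy => C.basicOpen_le q (hV' hy)
  set k' : (V' : C.Opens) ⟶ V := homOfLE hV'V with hk'
  have hq' : IsUnit (C.presheaf.map k'.op q) := by
    have h1 : IsUnit (C.presheaf.map (homOfLE (C.basicOpen_le q)).op q) :=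
      C.toLocallyRingedSpace.toRingedSpace.isUnit_res_basicOpen q
    have h2 : C.presheaf.map k'.op q = C.presheaf.map (homOfLE hV').op (C.presheaf.map (homOfLE (C.basicOpen_le q)).op q) := by
      rw [← CommRingCat.comp_apply, ← Functor.map_comp]; rfl
    rw [h2]
    exact h1.map _
  obtain ⟨a, ha⟩ := exists_appLE_smul_homBasis_eq e₀ e₁ k' q hq' b
  refine ⟨a, 0, ?_⟩
  rw [smul_zero, add_zero, ← ha, ← hq, huV, appLE_restrictHom]
  exact appLE_congr_hom u _ _ a

end Main

end Summit.ResolutionOfSingularities.ResolutionOfSingularities.Cruxes.EquisingularLiftNat.F102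

end
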